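import Summits.BirchSwinnertonDyer.BirchSwinnertonDyer.Theses.UniversalToricDescent
import Summits.BirchSwinnertonDyer.BirchSwinnertonDyer.Theorems.UniversalToricDescentToricTransportModThreeStubRatSqueeze
import Summits.BirchSwinnertonDyer.BirchSwinnertonDyer.Theorems.UniversalToricDescentAcDualMuZeroCriterion
import Summits.BirchSwinnertonDyer.Rank1Residual.WAll.TargetAdditiveAtThreeWildLocalTypeDecompLineMult
import HarnessLib

/-!
# Crux `AdditiveSplitIMCInclusionAtThree` (stmt-BirchSwinnertonDyer-20395) — node `nonordinary_source_transport`
# (crux-ideate cover g31; UNREGISTERED node, `sorry` only in `stub_*`; concludes the crux BY NAME)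

NON-ORDINARY SOURCE TRANSPORT (idea #39).  The wall = RATWALL ∧ (μ-half) (g7/g10; kernel road
`wall_of_ratwall_of_residualFinite` below, proof verbatim from g10/g14).  The μ-half
`ResidualSelmerFiniteAtThreeSurj` (`Sel_{𝔭′}(K_∞, E[3^∞])[3]` finite) is a statement about the RESIDUAL
representation `ρ̄ = E[3]` and the field `K` only: the `(∅ at 𝔭, 0 at 𝔭′)` local conditions are TYPE-BLIND at the
primes above 3 (no local points enter), and every prime of `N` splits in `K` (Heegner), hence is finitely decomposed
in `K_∞`, so Greenberg–Vatsal's imprimitive residual comparison transports the μ-half between ANY two modular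
realisations of `ρ̄` whose levels are built from primes of `N`.  The natural realisation to prove it on is the
SERRE-OPTIMAL one: by Ribet–Diamond–Edixhoven, on every row with Serre weight `k(ρ̄) = 2` there is a weight-2 newform
`g` of level `N(ρ̄) ∣ N/27`, PRIME TO 3, with `ρ̄_{g,λ} ≅ E[3]` — Heegner for the same `K` for free.  The TraceZero
barrier (`U₃ f_E = 0`: Heegner classes of 3-power conductor have trace ZERO, no `κ_∞`) is a property of the 3-LEVEL
`27 ∣ N` of `f_E`, not of `ρ̄`: the de-levelled source `g` has `3 ∤ N_g`, so its Heegner classes over the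
anticyclotomic tower obey Perrin-Riou's THREE-TERM relation `cor y_{n+1} = a₃(g) y_n − y_{n−1}` over the UNRAMIFIED
base `K_𝔭 = ℚ₃`.  This node dispatches the μ-half by the LOCAL TYPE of `ρ̄|D₃` into three strata:

* stratum R (`k = 2`, niveau 1 — `HasGoodOrdinaryModThreeType`, verbatim from node `serre_source_transport`, g14):
  `g` is λ-ORDINARY; engine = Howard's ordinary GL₂-type Heegner main-conjecture divisibility (+ BDP conversion +
  Hsieh).  SHARED stub `stub_serreSourceRows` (same text as g14's; not this node's contribution).
* stratum S (`k = 2`, niveau 2: `ρ̄|I₃ ≅ ω₂ ⊕ ω₂³` — NEW predicate `HasGoodSupersingularModThreeType`: the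
  `D₃`-module `W[3]` is the 3-torsion of SOME curve over `ℚ` with good SUPERSINGULAR reduction at 3; census bucket C,
  603 classes of record): `g` is NECESSARILY NON-ORDINARY at `λ` (Fontaine/Edixhoven: `ρ̄_g|I₃` irreducible), and the
  engine is the printed INTEGRAL NON-ORDINARY BDP DIVISIBILITY over `ℚ`:
  `𝔏_𝔭^{BDP}(g/K)² ∈ Char_Λ X_(∅,0)(g/K_∞) ⊗ Λ^{ur}` (Lei–Zhao 2023 Thm 1, integral refinement of Kobayashi–Ota 2020
  Thm 1.1: Heegner-point Kolyvagin system for non-ordinary `g` via the integral Perrin-Riou twist; hypotheses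
  `p ≥ 5`, `N_g > 3` square-free, `p ∤ 6 h_K N_g φ(N_g)`, `ord_p a_p(g) ≥ 1/(p+1)`, image `⊇ GL₂(ℤ_p)`, `d_K` odd or
  `8 ∣ d_K`) + Hsieh's `μ(𝔏_𝔭^{BDP}(g)) = 0` (any weight-2 `g`, `p` split; no ordinarity) ⇒ `μ(X_(∅,0)(g/K_∞)) = 0`
  ⇒ residual `(∅,0)`-finiteness for `A_g[λ]` ⇒ (GV transport along `A_g[λ] ≅ E[3] ⊗ 𝔽_λ`) the μ-half for `E`.
  NEW stub `stub_nonordinarySourceRows` — the node's load-bearing piece; its open leaf is the `p = 3` PORT of the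
  Lei–Zhao/Kobayashi–Ota divisibility (and the removal of `N_g` square-free / `3 ∤ h_K φ(N_g)`).
* edge strata (`k(ρ̄) = 4` très ramifié, bucket B; `k(ρ̄) = 6`): no weight-2 prime-to-3 source (`stub_edgeRows`,
  BARRIER — = the g14 sub-leaves (C4)/(C6), unchanged).

`residualFinite_of_three_strata` (excluded middle twice, PROVED) and `complementRows_of_nonordinary_and_edge` (PROVED:
this node's S/edge split REFINES g14's single complement stub) make the bookkeeping explicit; the TOP composition
`AdditiveSplitIMCInclusionAtThree_of` concludes the crux BY NAME.  The `Cruxes/…/Lines` modules are not built on the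
farm, so shared Props are restated with their exact text (no `Lines → Lines` import).
References: Lei–Zhao, *On the BDP Iwasawa main conjecture for modular forms*, Manuscripta Math. (2023)
[corpus: paper:arxiv-2211.04377 p3 (Thm 1, Thm 1.1 = Kobayashi–Ota), p2 L3 (`p ≥ 5`)]; Kobayashi–Ota, ASPM 86 (2020)
doi:10.2969/aspm/08610537; Castella–Wan, Math. Ann. (2023) [corpus: paper:arxiv-1607.02019 p3 L113, p4 Thm A/C
(`p > 3`, `a_p = 0`)]; Burungale–Büyükboduk–Lei, Adv. Math. 439 (2024) [arxiv-2211.03722 p2–3: definite setting,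
`p ≥ 5`]; Ribet–Stein, *Lectures on Serre's conjectures* §2.1–§3 [corpus: paper:doi-10-1090-pcms-009-04];
Edixhoven 1992 (weight in Serre's conjectures) §2; Hsieh 2014 Doc. Math. Thm B (tree fact `…anyLevel`);
Greenberg–Vatsal 2000 Prop. (2.8); node `serre_source_transport` (g14) for stratum R and the kernel road.
-/

set_option linter.dupNamespace false
set_option autoImplicit false

noncomputable section

open scoped NumberField
open IsDedekindDomain
open Literature.NumberTheory.EllipticCurves
open Literature.NumberTheory.EllipticCurves.Rank1Residual (GoodOrd GoodSS)
open Summit.BirchSwinnertonDyer.Rank1Residual.O6 (ModPCongruentAt)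
open Summit.BirchSwinnertonDyer.BirchSwinnertonDyer.Theses.UniversalToricDescent
  (RationalSplitIMCInclusionAtThree AdditiveSplitIMCInclusionAtThree)
open Summit.BirchSwinnertonDyer.BirchSwinnertonDyer.Cruxes.ToricTransportModThree.RatwallThinComb
  (dvd_of_dvd_prime_pow_mul prime_C_three not_C_three_dvd_of_norm_coeff_eq_one)
open Summit.BirchSwinnertonDyer.Rank1Residual.X11b

namespace Summit.BirchSwinnertonDyer.BirchSwinnertonDyer.Cruxes.AdditiveSplitIMCInclusionAtThree.NonordinarySourceTransport

/-! ## §0a The μ-half of the wall (verbatim from g8/g10/g14, same normalised signature) -/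

/-- μ-half (UNDECIDED): residual `(∅,0)`-Selmer finiteness `Sel_{𝔭′}(K_∞, E[3^∞])[3]` finite on the O6 / onto /
`r_an = 1` rows — equivalently `μ(X_(∅,0)) = 0` given torsion. Identical text to g8/g10/g14.
[cite: GreenbergVatsal2000, Thm. (1.4), §2 Prop. (2.8)] -/
def ResidualSelmerFiniteAtThreeSurj : Prop :=
  ∀ (W : WeierstrassCurve ℚ) [W.IsElliptic] [W.IsGloballyMinimal] (N : ℕ) [NeZero N]
    (K : Type) [Field K] [NumberField K],
    Summit.BirchSwinnertonDyer.Rank1Residual.Additive.ClassO6 W 3 → W.HasSurjectiveModNGaloisRep 3 →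
    W.analyticRank = 1 → W.conductorNorm ℤ = N →
    IsImaginaryQuadratic K → SatisfiesHeegnerHypothesis N K →
    ∀ (κ : ZpExtension K 3), κ.IsAnticyclotomic →
    ∀ (𝔭' : HeightOneSpectrum (𝓞 K)), ((3 : ℕ) : 𝓞 K) ∈ 𝔭'.asIdeal →
      Set.Finite {s : AcSelmer.selmerAc (W.baseChange K) 3 κ 𝔭' ∅ | (3 : ℕ) • s = 0}

/-! ## §0b The two source strata of `ρ̄|D₃` in tree vocabulary -/

/-- **Stratum R — good-ORDINARY mod-3 type at 3** (verbatim from node `serre_source_transport`, g14): the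
`D₃`-module `W[3]` is `D₃`-equivariantly isomorphic to `W″[3]` for SOME curve `W″/ℚ` with good ORDINARY reduction
at 3; Serre weight `k(ρ̄) = 2`, niveau 1.  [cite: SerreInventiones1972, §1.11 Prop. 11] [cite: Serre1987, §2.8 Prop. 3] -/
def HasGoodOrdinaryModThreeType (W : WeierstrassCurve ℚ) : Prop :=
  ∀ (v : HeightOneSpectrum (𝓞 ℚ)), ((3 : ℕ) : 𝓞 ℚ) ∈ v.asIdeal →
    ∃ (W'' : WeierstrassCurve ℚ) (_ : W''.IsElliptic) (_ : W''.IsGloballyMinimal),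
      GoodOrd W'' 3 ∧ ModPCongruentAt W'' W 3 v

/-- **Stratum S — good-SUPERSINGULAR mod-3 type at 3 (NEW, this node).**  At the place above `3`, the
`D₃`-module `W[3]` is `D₃`-equivariantly isomorphic to `W″[3]` for SOME elliptic curve `W″/ℚ` with good
SUPERSINGULAR reduction at `3` (GLOBAL witness, LOCAL equivariance).  Equivalently (Serre 1972 §1.11 Prop. 12:
supersingular ⇒ `ρ̄|I₃ ≅ ω₂ ⊕ ω₂³`, irreducible on `D₃`; conversely every `Ind_{ℚ₉}^{ℚ₃}(ω₂·unr)` with cyclotomic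
determinant is the 3-torsion of a supersingular curve over `ℚ₃`, hence over `ℚ` by weak approximation + Krasner):
`k(ρ̄) = 2`, niveau 2 — census bucket C (603 classes of record).  On this stratum NO modular realisation of `ρ̄` of
level prime to 3 is ordinary (Fontaine/Edixhoven), so every Serre source is NON-ORDINARY at `λ`.  [folklore]
[cite: SerreInventiones1972, §1.11 Prop. 12] [cite: Serre1987, §2.2, §2.4 (niveau 2, `k = 1 + b`, `(a,b) = (0,1)`)] -/
def HasGoodSupersingularModThreeType (W : WeierstrassCurve ℚ) : Prop :=
  ∀ (v : HeightOneSpectrum (𝓞 ℚ)), ((3 : ℕ) : 𝓞 ℚ) ∈ v.asIdeal →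
    ∃ (W'' : WeierstrassCurve ℚ) (_ : W''.IsElliptic) (_ : W''.IsGloballyMinimal),
      GoodSS W'' 3 ∧ ModPCongruentAt W'' W 3 v

/-! ## §1 The three row pieces of the μ-half (same binders as `ResidualSelmerFiniteAtThreeSurj`, split by §0b) -/

/-- **Stratum-R μ-piece (UNDECIDED · SHARED with node `serre_source_transport` g14, verbatim text; ordinary
Serre source + Howard).** [cite: GreenbergVatsal2000, Thm. (1.4), §2 Prop. (2.8)] -/
def SerreSourceResidualFiniteAtThree : Prop :=
  ∀ (W : WeierstrassCurve ℚ) [W.IsElliptic] [W.IsGloballyMinimal] (N : ℕ) [NeZero N]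
    (K : Type) [Field K] [NumberField K],
    Summit.BirchSwinnertonDyer.Rank1Residual.Additive.ClassO6 W 3 → W.HasSurjectiveModNGaloisRep 3 →
    W.analyticRank = 1 → W.conductorNorm ℤ = N →
    IsImaginaryQuadratic K → SatisfiesHeegnerHypothesis N K →
    HasGoodOrdinaryModThreeType W →
    ∀ (κ : ZpExtension K 3), κ.IsAnticyclotomic →
    ∀ (𝔭' : HeightOneSpectrum (𝓞 K)), ((3 : ℕ) : 𝓞 K) ∈ 𝔭'.asIdeal →
      Set.Finite {s : AcSelmer.selmerAc (W.baseChange K) 3 κ 𝔭' ∅ | (3 : ℕ) • s = 0}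

/-- **Stratum-S μ-piece — the NON-ORDINARY SOURCE (NEW · UNDECIDED · print-adjacent `p = 3` PORT; the node's
load-bearing piece).**  On the O6 / onto / `r_an = 1` rows whose mod-3 type at 3 is good-supersingular,
`Sel_{𝔭′}(K_∞, E[3^∞])[3]` is finite.  Proof route: (S1) Ribet–Diamond–Edixhoven: a newform
`g ∈ S₂(Γ₀(N(ρ̄)))`, `N(ρ̄) ∣ N/27`, `3 ∤ N(ρ̄)`, `ρ̄_{g,λ} ≅ E[3]`, Heegner for `K` (every prime of `N(ρ̄)` divides
`N`), non-ordinary at `λ`; (S2) ENGINE: Lei–Zhao 2023 Thm 1 / Kobayashi–Ota 2020 (integral non-ordinary BDP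
divisibility `𝔏_𝔭(g/K)² ∈ Char X_(∅,0)(g/K_∞) ⊗ Λ^{ur}`, Heegner-point Kolyvagin system + integral Perrin-Riou
twist over the UNRAMIFIED base `ℚ₃`) + Hsieh Thm B ⇒ `μ(X_(∅,0)(g/K_∞)) = 0`; (S3) GV imprimitive residual
comparison along `A_g[λ] ≅ E[3] ⊗ 𝔽_λ` with TYPE-BLIND `(∅,0)` conditions at `w ∣ 3` and finitely decomposed
(split) primes of `N` ⇒ the set below is finite.  Why it might fail: the engine is printed for `p ≥ 5` only
(`p ∤ 6h_K N_g φ(N_g)`, `N_g` square-free, image ⊇ `GL₂(ℤ_p)`, `ord_p a_p ≥ 1/(p+1)`, `d_K` odd or `8 ∣ d_K`):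
at `p = 3` the Kolyvagin-system hypotheses need the 3-ADIC image of `g` (mod-3 onto does not give mod-9 onto),
`3 ∣ φ(N_g)` whenever some `q ∣ N_g` has `q ≡ 1 (3)`, and `N(ρ̄)` is not square-free when `E` has a second additive
prime. [cite: GreenbergVatsal2000, Thm. (1.4), §2 Prop. (2.8)] -/
def NonordinarySourceResidualFiniteAtThree : Prop :=
  ∀ (W : WeierstrassCurve ℚ) [W.IsElliptic] [W.IsGloballyMinimal] (N : ℕ) [NeZero N]
    (K : Type) [Field K] [NumberField K],
    Summit.BirchSwinnertonDyer.Rank1Residual.Additive.ClassO6 W 3 → W.HasSurjectiveModNGaloisRep 3 →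
    W.analyticRank = 1 → W.conductorNorm ℤ = N →
    IsImaginaryQuadratic K → SatisfiesHeegnerHypothesis N K →
    HasGoodSupersingularModThreeType W →
    ∀ (κ : ZpExtension K 3), κ.IsAnticyclotomic →
    ∀ (𝔭' : HeightOneSpectrum (𝓞 K)), ((3 : ℕ) : 𝓞 K) ∈ 𝔭'.asIdeal →
      Set.Finite {s : AcSelmer.selmerAc (W.baseChange K) 3 κ 𝔭' ∅ | (3 : ℕ) • s = 0}

/-- **Edge-strata μ-piece (UNDECIDED; BARRIER leaves = g14 (C4)/(C6)).** The same finiteness on the rows whose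
mod-3 type at 3 is NEITHER good-ordinary NOR good-supersingular: `k(ρ̄) = 4` très ramifié (weight-4 source at the
Fontaine–Laffaille edge; weight-2 sources are the multiplicative twins, `NoAdmissiblePrimesAtThree`) and
`k(ρ̄) = 6`.  No print engine; recorded so that the composition concludes the crux over ALL rows. [folklore] -/
def EdgeRowsResidualFiniteAtThree : Prop :=
  ∀ (W : WeierstrassCurve ℚ) [W.IsElliptic] [W.IsGloballyMinimal] (N : ℕ) [NeZero N]
    (K : Type) [Field K] [NumberField K],
    Summit.BirchSwinnertonDyer.Rank1Residual.Additive.ClassO6 W 3 → W.HasSurjectiveModNGaloisRep 3 →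
    W.analyticRank = 1 → W.conductorNorm ℤ = N →
    IsImaginaryQuadratic K → SatisfiesHeegnerHypothesis N K →
    ¬ HasGoodOrdinaryModThreeType W → ¬ HasGoodSupersingularModThreeType W →
    ∀ (κ : ZpExtension K 3), κ.IsAnticyclotomic →
    ∀ (𝔭' : HeightOneSpectrum (𝓞 K)), ((3 : ℕ) : 𝓞 K) ∈ 𝔭'.asIdeal →
      Set.Finite {s : AcSelmer.selmerAc (W.baseChange K) 3 κ 𝔭' ∅ | (3 : ℕ) • s = 0}

/-- g14's single complement stratum (verbatim text of node `serre_source_transport`), restated so that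
`complementRows_of_nonordinary_and_edge` can certify that this node REFINES it. [folklore] -/
def ComplementRowsResidualFiniteAtThree : Prop :=
  ∀ (W : WeierstrassCurve ℚ) [W.IsElliptic] [W.IsGloballyMinimal] (N : ℕ) [NeZero N]
    (K : Type) [Field K] [NumberField K],
    Summit.BirchSwinnertonDyer.Rank1Residual.Additive.ClassO6 W 3 → W.HasSurjectiveModNGaloisRep 3 →
    W.analyticRank = 1 → W.conductorNorm ℤ = N →
    IsImaginaryQuadratic K → SatisfiesHeegnerHypothesis N K →
    ¬ HasGoodOrdinaryModThreeType W →
    ∀ (κ : ZpExtension K 3), κ.IsAnticyclotomic →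
    ∀ (𝔭' : HeightOneSpectrum (𝓞 K)), ((3 : ℕ) : 𝓞 K) ∈ 𝔭'.asIdeal →
      Set.Finite {s : AcSelmer.selmerAc (W.baseChange K) 3 κ 𝔭' ∅ | (3 : ℕ) • s = 0}

/-! ## §2 Glue (PROVED): the three strata exhaust the rows; the S/edge split refines g14's complement -/

/-- Excluded middle on the two source strata: the three row pieces give the μ-half of the wall verbatim. [folklore] -/
theorem residualFinite_of_three_strata :
    SerreSourceResidualFiniteAtThree → NonordinarySourceResidualFiniteAtThree → EdgeRowsResidualFiniteAtThree →
      ResidualSelmerFiniteAtThreeSurj := by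
  intro hR hS hE W _ _ N _ K _ _ hO6 hsurj hr1 hN hK hH κ hκ 𝔭' h3'
  by_cases hrow : HasGoodOrdinaryModThreeType W
  · exact hR W N K hO6 hsurj hr1 hN hK hH hrow κ hκ 𝔭' h3'
  · by_cases hss : HasGoodSupersingularModThreeType W
    · exact hS W N K hO6 hsurj hr1 hN hK hH hss κ hκ 𝔭' h3'
    · exact hE W N K hO6 hsurj hr1 hN hK hH hrow hss κ hκ 𝔭' h3'

/-- **This node refines g14**: the non-ordinary source on stratum S and the edge piece together give g14's single
complement stub `ComplementRowsResidualFiniteAtThree` (so the g14 kernel runs on this node's pieces too). [folklore] -/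
theorem complementRows_of_nonordinary_and_edge :
    NonordinarySourceResidualFiniteAtThree → EdgeRowsResidualFiniteAtThree → ComplementRowsResidualFiniteAtThree := by
  intro hS hE W _ _ N _ K _ _ hO6 hsurj hr1 hN hK hH hrow κ hκ 𝔭' h3'
  by_cases hss : HasGoodSupersingularModThreeType W
  · exact hS W N K hO6 hsurj hr1 hN hK hH hss κ hκ 𝔭' h3'
  · exact hE W N K hO6 hsurj hr1 hN hK hH hrow hss κ hκ 𝔭' h3'

/-- **Stratum S is closed under mod-3 congruence AT 3** (a property of the `D₃`-module `W[3]` only): bookkeeping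
for the transport step (S3). [folklore] -/
theorem HasGoodSupersingularModThreeType.of_modPCongruentAt {W W' : WeierstrassCurve ℚ}
    (h : HasGoodSupersingularModThreeType W)
    (hc : ∀ (v : HeightOneSpectrum (𝓞 ℚ)), ((3 : ℕ) : 𝓞 ℚ) ∈ v.asIdeal → ModPCongruentAt W W' 3 v) :
    HasGoodSupersingularModThreeType W' := by
  intro v hv
  obtain ⟨W'', h1, h2, hss, hW⟩ := h v hv
  exact ⟨W'', h1, h2, hss, hW.trans (hc v hv)⟩

/-- A good-supersingular curve lies in stratum S (witness: itself). [folklore] -/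
theorem hasGoodSupersingularModThreeType_of_goodSS (W : WeierstrassCurve ℚ) [W.IsElliptic] [W.IsGloballyMinimal]
    (h : GoodSS W 3) : HasGoodSupersingularModThreeType W :=
  fun v _ ↦ ⟨W, ‹_›, ‹_›, h, ModPCongruentAt.refl (W := W) (p := 3) (v := v)⟩

/-- The two source strata are the two halves of `k(ρ̄) = 2` and a curve witnesses at most one of `GoodOrd`/`GoodSS`:
`GoodOrd W 3` and `GoodSS W 3` are contradictory (`3 ∤ a₃` vs `3 ∣ a₃`). [folklore] -/
theorem not_goodOrd_and_goodSS (W : WeierstrassCurve ℚ) [W.IsGloballyMinimal] :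
    ¬ (GoodOrd W 3 ∧ GoodSS W 3) := by
  rintro ⟨⟨_, hnd⟩, ⟨_, hd⟩⟩
  exact hnd hd

/-! ## §3 Registered-shape stubs (`sorry` only here) -/

/-- RATWALL (route crux 24207, WEAKER than the wall; LEAD line `ratwall_thin_comb`). -/
theorem stub_ratwall : RationalSplitIMCInclusionAtThree := by
  sorry

/-- Stratum R: the ORDINARY Serre source (UNDECIDED · SHARED with node `serre_source_transport`, g14). -/
theorem stub_serreSourceRows : SerreSourceResidualFiniteAtThree := by
  sorry

/-- Stratum S: the NON-ORDINARY Serre source (NEW · UNDECIDED · `p = 3` port of Lei–Zhao 2023 Thm 1 /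
Kobayashi–Ota 2020 + Hsieh Thm B + GV residual transport). -/
theorem stub_nonordinarySourceRows : NonordinarySourceResidualFiniteAtThree := by
  sorry

/-- Edge strata `k(ρ̄) ∈ {4, 6}` (UNDECIDED · BARRIER leaves). -/
theorem stub_edgeRows : EdgeRowsResidualFiniteAtThree := by
  sorry

/-! ## §4 TOP composition: the crux BY NAME -/

/-- **The μ-half road (g10/g14 kernel road, proof verbatim).** `Sel_{𝔭′}(K_∞,E[3^∞])[3]` finite makes `X = X_(∅,0)`
`Λ`-torsion with `Ch·R₀⟦T⟧ = (g)`, `g` having a unit coefficient (LANDED criterion, GV 2.8 shape); then `3 ∤ g` in the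
domain `R₀⟦T⟧` where `3` is prime, so `g ∣ 3^k·L` (RATWALL) forces `g ∣ L`, i.e. `(L) ⊆ (g)`.
[cite: GreenbergVatsal2000, §2 Prop. (2.8)] [cite: Washington1997, §7.1, §13.2] -/
theorem wall_of_ratwall_of_residualFinite :
    RationalSplitIMCInclusionAtThree → ResidualSelmerFiniteAtThreeSurj → AdditiveSplitIMCInclusionAtThree := by
  intro hR hF W _ _ N _ K _ _ Dt hO6 hsurj hr1 hN hK hH κ hκ γ _ 𝔭 h3 he hf 𝔭' h3' hne ι' hι ΩK Ωp L hΩK hΩp hL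
  obtain ⟨k, hk⟩ := hR W N K Dt hO6 hsurj hr1 hN hK hH κ hκ γ 𝔭 h3 he hf 𝔭' h3' hne ι' hι ΩK Ωp L hΩK hΩp hL
  have hfin := hF W N K hO6 hsurj hr1 hN hK hH κ hκ 𝔭' h3'
  obtain ⟨-, g, hg, i, hi⟩ :=
    Summit.BirchSwinnertonDyer.BirchSwinnertonDyer.Theorems.UniversalToricDescentAcDualMuZero.isTorsion_and_exists_generator_of_finite_pTorsion
      (W.baseChange K) 3 κ 𝔭' ∅ γ Set.finite_empty hfin
  rw [hg] at hk ⊢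
  have hdvd : g ∣ ((3 : ℕ) : UnrSeries 3) ^ k * L := Ideal.mem_span_singleton.mp hk
  rw [← map_natCast (PowerSeries.C (R := unrIntegers 3))] at hdvd
  exact Ideal.span_singleton_le_span_singleton.mpr
    (dvd_of_dvd_prime_pow_mul prime_C_three (not_C_three_dvd_of_norm_coeff_eq_one hi) k hdvd)

/-- **The wall from RATWALL + the ordinary source (R) + the NON-ORDINARY source (S) + the edge strata.**  Concludes
`AdditiveSplitIMCInclusionAtThree` BY NAME. [cite: GreenbergVatsal2000, §2 Prop. (2.8)] -/
theorem AdditiveSplitIMCInclusionAtThree_of :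
    RationalSplitIMCInclusionAtThree → SerreSourceResidualFiniteAtThree → NonordinarySourceResidualFiniteAtThree →
      EdgeRowsResidualFiniteAtThree → AdditiveSplitIMCInclusionAtThree :=
  fun hRW hR hS hE ↦ wall_of_ratwall_of_residualFinite hRW (residualFinite_of_three_strata hR hS hE)

/-- The top composition run on the registered-shape stubs: the crux BY NAME (sorries only through `stub_*`). -/
theorem AdditiveSplitIMCInclusionAtThree_holds_of_stubs : AdditiveSplitIMCInclusionAtThree :=
  AdditiveSplitIMCInclusionAtThree_of stub_ratwall stub_serreSourceRows stub_nonordinarySourceRows stub_edgeRows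

end Summit.BirchSwinnertonDyer.BirchSwinnertonDyer.Cruxes.AdditiveSplitIMCInclusionAtThree.NonordinarySourceTransport

end
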